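import Summits.QuantumFields.BalabanUV.T4Continuum.Support.NE7EtaRatesD4

/-!
# NE7EtaRatesD4Root — route #1 of the NE7 crux, hardest stub S1∕L7b-background: the rates of `NE7EtaRatesD4` threaded through
# row NE3's re-typed root T-E_w (`NE3EnergyWeightedShapes.NE3EnergyRateW` — the WEAKER root, no sup conjunct) for Bałaban's pair
# «run-A minimiser gauge-fixed = once-averaged run-B minimiser varied along `Z`», all four U-slot coordinates in one display

Cell `pub-balaban`, rung (B)+1 sub-cell t4, lineage `b2b-balaban-t4-ne7-p1`, generation 22 (CRUX PROVER NE7 #1, ruling e34b3e0c); crux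
skeleton `t4/skeletons/NE7-CRUX-R1.md` v1.6 §3ter.  HONEST FRAMING (page 1): FIXED FINITE T⁴, rung (B)+1; NE7, NE3 NOT PRINTED in
[Balaban1984PropagatorsI]–[Balaban1989LargeFieldII] and NOT PROVED here; continuum YM on T⁴ ⇐ BetaPertH ∧ nine spine estimates (0/9 proved);
BetaPertH ⇐ (D1) ∧ (D4) ∧ CAP+tail; G-an2-4 gates asym, D1 and NE2/3/4; NOT infinite volume, NOT mass gap, NOT Clay.

THE DISPLAY (`closeness_rates_of_ne3EnergyRateW`).  `d = 4`, `L ≥ 2`, `N ≥ 1`, `θ⁶ = L⁻¹`; T-E_w `NE3EnergyRateW 4 𝒞 L N b g C dom` with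
`C, g ≥ 0` and a budget `γ > 0`, `C·ρ₄ ≤ γ³` (`ρ₄ = wallConst 4 L·N²·(√g·dualC2 + 2b²·dualC1)`, k-FREE); `k ≥ 1`, `V ∈ dom`, `UA` a run-A
minimiser (level `k`), `UB` a regular run-B minimiser (level `k+1`) whose once-averaged `W = rescale L (bavg L UB)` is unitary and
`N L^k`-periodic (one-run facts, displayed).  Then the root's pair `(u, Z)` (`gaugeAct u UA = vary W Z 1`) satisfies, FOR EVERY Lipschitz
data the produced `Z` happens to have — (Lip₁) `Λ₁ ≤ l₁³`, (Lip₂′) `Λ₂′ > 0`, (Lip₂) on a plane `Λ₂ ≤ l₂³` — and under the FIT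
`γθ^{2k} ≤ l·N`:
  (P) `‖Z x κ‖ ≤ 8l₁²γ·θ^{8k}`,  (G) `‖Z (x + e μ) κ − Z x κ‖ ≤ 4l₁√(2γΛ₂′)·θ^{13k}`,
  (C) `‖d_W Z (x; μ < ν)‖ ≤ 8l₂²γ·θ^{14k}`,  (Q) `‖(gaugeAct u UA)(∂p) − W(∂p)‖ ≤ (8l₂²γ + 1536l₁⁴γ²e^{8l₁²γ})·θ^{14k}`
— margins `ξ = θ^{6k}` (field-unit potential), `ξ² = θ^{12k}` (gradient, (1.14)–(1.15)): every coordinate of the (1.13)–(1.14) currency of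
[Balaban1987RG1] p. 262 is GEOMETRICALLY small along the tower, conditional on T-E_w + (Lip₁)(Lip₂)(Lip₂′) — EXACTLY the re-typed
INTERFACE REQUEST NE7→NE3 (WAKE-1 + addendum; the sup conjunct of T-E_w♯ is not asked: `closeness_rates_of_ne3EnergyRateWSup` is the
one-line projection for holders of T-E_w♯).  With `exists_fit_threshold` ∕ `exists_geometric_majorant` of `NE7EtaRatesD4` this is the
binder `hclose … ≤ δc K`, `δc K ≤ C₃θ₃^K` of `T4TowerRateComposition.uRateUpTo_tower` ∕ `argBracket_tower` for route #1 — MODULO NODE O's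
carrier (which coordinate∕gauge reading the carrier's `gauge` is; ownerless) and modulo row NE3 delivering the root (unseated).
HONEST.  A composition ([folklore]); nothing of NE3∕NE7 discharged; 0 def; 0 sorry; nothing printed is a hypothesis of a theorem.
-/

set_option autoImplicit false

open scoped BigOperators Matrix Matrix.Norms.L2Operator
open Finset

namespace Summit.QuantumFields.BalabanUV.T4Continuum.NE7EtaRatesD4Root

open Literature.MathematicalPhysics.QuantumFieldTheory.Balaban1983to89
open B7Prop1Explicit B7Prop2Explicit
open T4AveragingDeficitWall hiding Site Plane Plaq Bond
open T4AveragingDeficitWallBoundary (periodBox IsPeriodicCfg)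
open AveragingDeficitPeriodicCounting (IsPeriodicDir)
open MinimalActionSandwich (IsMinimiser)
open MinimalActionRate (Regular)
open NE3EnergyShapes (residualScale residualScale_nonneg IsUnitarySite IsPeriodicSite)
open NE3EnergyWeightedShapes (energyNormW energyNormW_nonneg NE3EnergyRateW)
open NE3EnergyWeightedSupShape (NE3EnergyRateWSup ne3EnergyRateW_of_sup)
open AveragingDeficitDualResidual (dualC1 dualC2)
open AveragingDeficitDerivWallProof (wallConst)
open NE7EtaRatesD4 (norm_dir_le_rate norm_curl_le_rate norm_dirDiff_le_rate norm_hol_sub_le_rate energy_budget_of_residualScale)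

noncomputable section

variable {n : Type*} [Fintype n] [DecidableEq n] [Nonempty n]

/-- **THE FOUR COORDINATES AT GEOMETRIC RATE, THROUGH T-E_w** (module docstring). [folklore] -/
theorem closeness_rates_of_ne3EnergyRateW {𝒞 : ℕ → Set (Site 4 → Fin 4 → (Matrix n n ℂ)ˣ)} {L N : ℕ} (hL : 2 ≤ L)
    (hN : 1 ≤ N) {θ : ℝ} (hθ : 0 < θ) (hθ6 : θ ^ 6 = ((L : ℝ))⁻¹) {b g C : ℝ} (hg : 0 ≤ g) (hC : 0 ≤ C)
    {dom : Set (Site 4 → Fin 4 → (Matrix n n ℂ)ˣ)} (h : NE3EnergyRateW 4 𝒞 L N b g C dom) {γ : ℝ} (hγ : 0 < γ)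
    (hγ3 : C * (wallConst 4 L * (N : ℝ) ^ 2 * (Real.sqrt g * dualC2 4 L + 2 * b ^ 2 * dualC1 4 L)) ≤ γ ^ 3)
    {k : ℕ} (hk : 1 ≤ k) {V : Site 4 → Fin 4 → (Matrix n n ℂ)ˣ} (hV : V ∈ dom)
    {UA UB : Site 4 → Fin 4 → (Matrix n n ℂ)ˣ} (hA : IsMinimiser 4 𝒞 L N k V UA) (hB : IsMinimiser 4 𝒞 L N (k + 1) V UB)
    (hreg : Regular 4 L N b g (k + 1) UB) (hWu : IsUnitaryCfg (rescale L (bavg L UB)))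
    (hWP : IsPeriodicCfg (rescale L (bavg L UB)) ((N * L ^ k : ℕ) : ℤ)) :
    ∃ (u : Site 4 → (Matrix n n ℂ)ˣ) (Z : Site 4 → Fin 4 → Matrix n n ℂ),
      IsUnitarySite u ∧ IsPeriodicSite u ((N * L ^ k : ℕ) : ℤ) ∧ IsSkewDir Z ∧ IsPeriodicDir Z ((N * L ^ k : ℕ) : ℤ) ∧
      gaugeAct u UA = vary (rescale L (bavg L UB)) Z 1 ∧
      -- (P) + (G): potential and gradient, from (Lip₁) + (Lip₂′) + FIT(l₁)
      (∀ (Λ₁ l₁ Λ₂' : ℝ), 0 < l₁ → Λ₁ ≤ l₁ ^ 3 → 0 < Λ₂' →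
        (∀ (κ : Fin 4) (x : Site 4) (μ : Fin 4), ‖Z (x + e μ) κ - Z x κ‖ ≤ Λ₁ * (((L : ℝ)⁻¹) ^ k) ^ 2) →
        (∀ (κ μ : Fin 4) (y : Site 4),
          ‖(Z (y + (2 : ℕ) • e μ) κ - Z (y + e μ) κ) - (Z (y + e μ) κ - Z y κ)‖ ≤ Λ₂' * (((L : ℝ)⁻¹) ^ k) ^ 3) →
        γ * (θ ^ k) ^ 2 ≤ l₁ * N →
          (∀ (x : Site 4) (κ : Fin 4), ‖Z x κ‖ ≤ 8 * l₁ ^ 2 * γ * θ ^ (8 * k)) ∧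
          (∀ (x : Site 4) (μ κ : Fin 4), ‖Z (x + e μ) κ - Z x κ‖ ≤ 4 * l₁ * Real.sqrt (2 * γ * Λ₂') * θ ^ (13 * k))) ∧
      -- (C) + (Q): curl and plaquette on the plane μ < ν, from (Lip₁) + (Lip₂) + both FITs
      (∀ (μ ν : Fin 4) (hμν : μ < ν) (Λ₁ l₁ Λ₂ l₂ : ℝ), 0 < l₁ → Λ₁ ≤ l₁ ^ 3 → 0 < l₂ → Λ₂ ≤ l₂ ^ 3 →
        (∀ (κ : Fin 4) (x : Site 4) (ρ : Fin 4), ‖Z (x + e ρ) κ - Z x κ‖ ≤ Λ₁ * (((L : ℝ)⁻¹) ^ k) ^ 2) →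
        (∀ (x : Site 4) (ρ : Fin 4),
          ‖curl (rescale L (bavg L UB)) Z (x + e ρ, ⟨(μ, ν), hμν⟩) - curl (rescale L (bavg L UB)) Z (x, ⟨(μ, ν), hμν⟩)‖
            ≤ Λ₂ * (((L : ℝ)⁻¹) ^ k) ^ 3) →
        γ * (θ ^ k) ^ 2 ≤ l₁ * N → γ * (θ ^ k) ^ 2 ≤ l₂ * N →
          (∀ x : Site 4, ‖curl (rescale L (bavg L UB)) Z (x, ⟨(μ, ν), hμν⟩)‖ ≤ 8 * l₂ ^ 2 * γ * θ ^ (14 * k)) ∧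
          (∀ z : Site 4,
            ‖((hol (gaugeAct u UA) z (plaqWord μ ν) : (Matrix n n ℂ)ˣ) : Matrix n n ℂ)
                - ((hol (rescale L (bavg L UB)) z (plaqWord μ ν) : (Matrix n n ℂ)ˣ) : Matrix n n ℂ)‖
              ≤ (8 * l₂ ^ 2 * γ + 1536 * l₁ ^ 4 * γ ^ 2 * Real.exp (8 * l₁ ^ 2 * γ)) * θ ^ (14 * k))) := by
  obtain ⟨u, Z, hu, huP, hZ, hZP, hrep, hE⟩ := h k hk V hV UA UB hA hB hreg
  have hL1 : 1 ≤ L := by omega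
  -- the k-free energy budget: L^k · E ≤ C ρ₄ ≤ γ³
  have hEγ : (L : ℝ) ^ k * energyNormW L k (rescale L (bavg L UB)) Z (periodBox (d := 4) (N * L ^ k)) ≤ γ ^ 3 :=
    (energy_budget_of_residualScale hL1 N b hg hC k hE).trans hγ3
  refine ⟨u, Z, hu, huP, hZ, hZP, hrep, ?_, ?_⟩
  · intro Λ₁ l₁ Λ₂' hl₁ hΛl hΛ₂' hlip hlip2 hfit
    exact ⟨fun x κ => norm_dir_le_rate hL hN hk hθ hθ6 hWP hZP hγ hl₁ hΛl hEγ hlip hfit x κ,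
      fun x μ κ => norm_dirDiff_le_rate hL hN hk hθ hθ6 hWP hZP hγ hl₁ hΛl hΛ₂' hEγ hlip hlip2 hfit x μ κ⟩
  · intro μ ν hμν Λ₁ l₁ Λ₂ l₂ hl₁ hΛl₁ hl₂ hΛl₂ hlip hlip' hfit₁ hfit₂
    refine ⟨fun x => norm_curl_le_rate hL hN hk hθ hθ6 hWP hZP hγ hl₂ hΛl₂ hEγ ⟨(μ, ν), hμν⟩ hlip' hfit₂ x, fun z => ?_⟩
    rw [hrep]
    exact norm_hol_sub_le_rate hL hN hk hθ hθ6 hWu hZ hWP hZP hγ hl₁ hΛl₁ hl₂ hΛl₂ hEγ hlip z hμν hlip' hfit₁ hfit₂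

/-- The same through T-E_w♯ (`NE3EnergyRateWSup`, sup conjunct present but UNUSED): one-line projection `ne3EnergyRateW_of_sup` —
for holders of the gen-19∕20 root of record. [folklore] -/
theorem closeness_rates_of_ne3EnergyRateWSup {𝒞 : ℕ → Set (Site 4 → Fin 4 → (Matrix n n ℂ)ˣ)} {L N : ℕ} (hL : 2 ≤ L)
    (hN : 1 ≤ N) {θ : ℝ} (hθ : 0 < θ) (hθ6 : θ ^ 6 = ((L : ℝ))⁻¹) {b g C s : ℝ} (hg : 0 ≤ g) (hC : 0 ≤ C)
    {dom : Set (Site 4 → Fin 4 → (Matrix n n ℂ)ˣ)} (h : NE3EnergyRateWSup 4 𝒞 L N b g C s dom) {γ : ℝ} (hγ : 0 < γ)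
    (hγ3 : C * (wallConst 4 L * (N : ℝ) ^ 2 * (Real.sqrt g * dualC2 4 L + 2 * b ^ 2 * dualC1 4 L)) ≤ γ ^ 3)
    {k : ℕ} (hk : 1 ≤ k) {V : Site 4 → Fin 4 → (Matrix n n ℂ)ˣ} (hV : V ∈ dom)
    {UA UB : Site 4 → Fin 4 → (Matrix n n ℂ)ˣ} (hA : IsMinimiser 4 𝒞 L N k V UA) (hB : IsMinimiser 4 𝒞 L N (k + 1) V UB)
    (hreg : Regular 4 L N b g (k + 1) UB) (hWu : IsUnitaryCfg (rescale L (bavg L UB)))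
    (hWP : IsPeriodicCfg (rescale L (bavg L UB)) ((N * L ^ k : ℕ) : ℤ)) :
    ∃ (u : Site 4 → (Matrix n n ℂ)ˣ) (Z : Site 4 → Fin 4 → Matrix n n ℂ),
      IsUnitarySite u ∧ IsPeriodicSite u ((N * L ^ k : ℕ) : ℤ) ∧ IsSkewDir Z ∧ IsPeriodicDir Z ((N * L ^ k : ℕ) : ℤ) ∧
      gaugeAct u UA = vary (rescale L (bavg L UB)) Z 1 ∧
      (∀ (Λ₁ l₁ Λ₂' : ℝ), 0 < l₁ → Λ₁ ≤ l₁ ^ 3 → 0 < Λ₂' →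
        (∀ (κ : Fin 4) (x : Site 4) (μ : Fin 4), ‖Z (x + e μ) κ - Z x κ‖ ≤ Λ₁ * (((L : ℝ)⁻¹) ^ k) ^ 2) →
        (∀ (κ μ : Fin 4) (y : Site 4),
          ‖(Z (y + (2 : ℕ) • e μ) κ - Z (y + e μ) κ) - (Z (y + e μ) κ - Z y κ)‖ ≤ Λ₂' * (((L : ℝ)⁻¹) ^ k) ^ 3) →
        γ * (θ ^ k) ^ 2 ≤ l₁ * N →
          (∀ (x : Site 4) (κ : Fin 4), ‖Z x κ‖ ≤ 8 * l₁ ^ 2 * γ * θ ^ (8 * k)) ∧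
          (∀ (x : Site 4) (μ κ : Fin 4), ‖Z (x + e μ) κ - Z x κ‖ ≤ 4 * l₁ * Real.sqrt (2 * γ * Λ₂') * θ ^ (13 * k))) ∧
      (∀ (μ ν : Fin 4) (hμν : μ < ν) (Λ₁ l₁ Λ₂ l₂ : ℝ), 0 < l₁ → Λ₁ ≤ l₁ ^ 3 → 0 < l₂ → Λ₂ ≤ l₂ ^ 3 →
        (∀ (κ : Fin 4) (x : Site 4) (ρ : Fin 4), ‖Z (x + e ρ) κ - Z x κ‖ ≤ Λ₁ * (((L : ℝ)⁻¹) ^ k) ^ 2) →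
        (∀ (x : Site 4) (ρ : Fin 4),
          ‖curl (rescale L (bavg L UB)) Z (x + e ρ, ⟨(μ, ν), hμν⟩) - curl (rescale L (bavg L UB)) Z (x, ⟨(μ, ν), hμν⟩)‖
            ≤ Λ₂ * (((L : ℝ)⁻¹) ^ k) ^ 3) →
        γ * (θ ^ k) ^ 2 ≤ l₁ * N → γ * (θ ^ k) ^ 2 ≤ l₂ * N →
          (∀ x : Site 4, ‖curl (rescale L (bavg L UB)) Z (x, ⟨(μ, ν), hμν⟩)‖ ≤ 8 * l₂ ^ 2 * γ * θ ^ (14 * k)) ∧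
          (∀ z : Site 4,
            ‖((hol (gaugeAct u UA) z (plaqWord μ ν) : (Matrix n n ℂ)ˣ) : Matrix n n ℂ)
                - ((hol (rescale L (bavg L UB)) z (plaqWord μ ν) : (Matrix n n ℂ)ˣ) : Matrix n n ℂ)‖
              ≤ (8 * l₂ ^ 2 * γ + 1536 * l₁ ^ 4 * γ ^ 2 * Real.exp (8 * l₁ ^ 2 * γ)) * θ ^ (14 * k))) :=
  closeness_rates_of_ne3EnergyRateW hL hN hθ hθ6 hg hC (ne3EnergyRateW_of_sup h) hγ hγ3 hk hV hA hB hreg hWu hWP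

end

end Summit.QuantumFields.BalabanUV.T4Continuum.NE7EtaRatesD4Root
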